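import Literature.Analysis.SpecialFunctions.SpheroidalHarmonicGreen
import Literature.Analysis.SpecialFunctions.SpheroidalHarmonicLegendre
import HarnessLib

/-!
# Eigenvalue branches of the spheroidal shooting function: the local holomorphic branch (implicit
# function theorem) and continuation along real `κ ∈ [−K, 0]`

Topic `Literature/Analysis/SpecialFunctions` (namespace `Literature.Analysis.SpecialFunctions`),
continuing `SpheroidalHarmonicGreen.lean`. For the shooting function `F(ν, κ) = q'(1; m, ν, κ)`
(`sphmShoot`) — whose zeros are the parameters `(ν, κ)`, `ν = λ − m(m+1)`, `κ = a²(ω² − μ²)`, of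
the angular eigenfunctions of Shlapentokh-Rothman's mode ansatz (CMP 329 (2014), §2 (2.1), App. B)
— this file proves, with everything constructive from the tree's series and Mathlib's implicit
function theorem:

* `sphmShoot_conj` — conjugation symmetry `F(conj ν, conj κ) = conj F(ν, κ)`;
* `exists_local_branch` — at a zero with `∂F/∂ν ≠ 0` (every REAL zero, by
  `sphmShoot_dnu_ne_zero`) the **local holomorphic branch** `κ ↦ ν(κ)` (Mathlib
  `ContDiffAt.implicitFunction` over `ℂ`), its local uniqueness, and `ν'(κ₀) = −(∂F/∂κ)/(∂F/∂ν)`;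
  `local_branch_real` — through a real zero the branch is real at real `κ`;
* `LocalRealBranch` / `exists_localRealBranch` — at every real zero: a real `C¹` branch on a
  window with `−1 ≤ ν' ≤ 0` capturing all real zeros in a box (SR Prop. B.3 in the form
  `0 ≤ (∂F/∂κ)/(∂F/∂ν) ≤ 1`, `sphmShoot_ratio_mem`);
* `exists_isGlobalBranch`, `exists_eigenvalue_branch` — **continuation**: from the Legendre zero
  `(ν, κ) = (n(n+2m+1), 0)`, `n` even (`sphmDer_one_eq_zero_of_even`), a continuous real branch on
  every `[−K, 0]` with `|ν(κ) − ν(0)| ≤ |κ|`, antitone, `ν + id` monotone (uniform extension steps of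
  size `λ/2`, `λ` a Lebesgue number of the local boxes over the compact bounded real zero set), its
  differentiability at interior points (`IsGlobalBranch.hasDerivAt`) and its agreement near interior
  points with the local holomorphic branch (`IsGlobalBranch.exists_holomorphic_extension`).

Not here: continuation for `κ > 0`, simplicity/ordering of the eigenvalues, `λ_{ml} → ∞`.

## References
* Y. Shlapentokh-Rothman, Comm. Math. Phys. 329 (2014) 859–891, §2 and App. B, Props. B.1, B.3
  (held copy `paper:arxiv-1302.3448`, Props. 8.1, 8.3). Key `ShlapentokhRothman2014KleinGordon`.
* P. Hartman, *Ordinary Differential Equations*, SIAM Classics 38 (2002), Ch. XI §4.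
  Key `Hartman2002`.
-/

noncomputable section

open Set Filter Metric
open scoped Topology ContDiff

/-! ### Conjugation symmetry of the shooting function -/

namespace Literature.Analysis.SpecialFunctions

open Literature.Analysis.ODE

section Conj

open scoped ComplexConjugate

/-- The coefficient triples are conjugation-equivariant: `cₖ(conj ν, conj κ) = conj cₖ(ν, κ)` (the
recursion has real rational coefficients). [folklore] -/
theorem sphmTriple_conj (m : ℕ) (ν κ : ℂ) (k : ℕ) :
    sphmTriple m (conj ν) (conj κ) k =
      (conj (sphmTriple m ν κ k).1, conj (sphmTriple m ν κ k).2.1, conj (sphmTriple m ν κ k).2.2) := by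
  induction k with
  | zero =>
    simp only [sphmTriple]
    refine Prod.ext ?_ (Prod.ext ?_ ?_)
    · simp
    · simp [map_div₀, map_ofNat]
    · simp [map_div₀, map_ofNat]
  | succ k ih =>
    simp only [sphmTriple, ih]
    refine Prod.ext rfl (Prod.ext rfl ?_)
    simp [map_div₀, map_ofNat]

/-- `cₖ(conj ν, conj κ) = conj cₖ(ν, κ)`. [folklore] -/
theorem sphmCoeff_conj (m : ℕ) (ν κ : ℂ) (k : ℕ) : sphmCoeff m (conj ν) (conj κ) k = conj (sphmCoeff m ν κ k) := by
  rw [sphmCoeff, sphmTriple_conj]; rfl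

/-- The unit-disc series commutes with conjugation. [folklore] -/
theorem cseries_conj (a : ℕ → ℂ) (x : ℂ) : cseries (fun k ↦ conj (a k)) (conj x) = conj (cseries a x) := by
  rw [cseries, cseries, Complex.conj_tsum]
  refine tsum_congr fun k ↦ ?_
  simp [map_mul, map_pow]

/-- **Conjugation symmetry of the shooting function**: `F(conj ν, conj κ) = conj F(ν, κ)`; in
particular `F` is real at real parameters and its zero set is invariant under conjugation.
[folklore] -/
theorem sphmShoot_conj (m : ℕ) (ν κ : ℂ) : sphmShoot m (conj ν, conj κ) = conj (sphmShoot m (ν, κ)) := by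
  simp only [sphmShoot, sphmDer]
  have hres : (fun k ↦ conj (dSeq (sphmResc54 m ν κ) k)) = dSeq (sphmResc54 m (conj ν) (conj κ)) := by
    funext k
    simp only [dSeq_apply, sphmResc54, sphmCoeff_conj, map_mul, map_pow, map_add, map_natCast, map_one,
      map_div₀, map_ofNat]
  have hx : conj ((4 / 5 : ℂ) * 1) = (4 / 5 : ℂ) * 1 := by simp [map_ofNat, map_div₀]
  rw [map_mul, ← cseries_conj, hres, hx]
  simp [map_div₀, map_ofNat]

end Conj

/-! ### The local branch through a non-degenerate zero (implicit function theorem) -/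

section LocalBranch

variable (m : ℕ)

/-- The shooting function with swapped arguments `(κ, ν) ↦ F(ν, κ)` (the shape wanted by the implicit
function theorem: parameter first, unknown second). [folklore] -/
def sphmShootSwap (q : ℂ × ℂ) : ℂ := sphmShoot m (q.2, q.1)

variable {m}

/-- `sphmShootSwap` is smooth. [folklore] -/
theorem contDiff_sphmShootSwap (m : ℕ) {n : WithTop ℕ∞} (hn : n ≤ ∞) : ContDiff ℂ n (sphmShootSwap m) :=
  (contDiff_sphmShoot m hn).comp (contDiff_snd.prodMk contDiff_fst)

/-- The `ν`-partial of the swapped function is multiplication by `∂F/∂ν`. [folklore] -/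
theorem fderiv_sphmShootSwap_comp_inr (m : ℕ) (κ₀ ν₀ : ℂ) :
    (fderiv ℂ (sphmShootSwap m) (κ₀, ν₀)).comp (ContinuousLinearMap.inr ℂ ℂ ℂ) =
      (fderiv ℂ (sphmShoot m) (ν₀, κ₀) (1, 0)) • ContinuousLinearMap.id ℂ ℂ := by
  have hF : DifferentiableAt ℂ (sphmShoot m) (ν₀, κ₀) :=
    (contDiff_sphmShoot m (n := 1) (by exact_mod_cast le_top)).differentiable one_ne_zero _
  have hswap : HasFDerivAt (fun q : ℂ × ℂ ↦ (q.2, q.1))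
      ((ContinuousLinearMap.snd ℂ ℂ ℂ).prod (ContinuousLinearMap.fst ℂ ℂ ℂ)) (κ₀, ν₀) :=
    hasFDerivAt_snd.prodMk hasFDerivAt_fst
  have hcomp : HasFDerivAt (sphmShootSwap m)
      ((fderiv ℂ (sphmShoot m) (ν₀, κ₀)).comp ((ContinuousLinearMap.snd ℂ ℂ ℂ).prod (ContinuousLinearMap.fst ℂ ℂ ℂ)))
      (κ₀, ν₀) := hF.hasFDerivAt.comp (κ₀, ν₀) hswap
  rw [hcomp.fderiv]
  ext
  simp
  -- `fderiv F (ν₀, κ₀) (x, 0) = x • fderiv F (ν₀, κ₀) (1, 0)`, evaluated at `x = 1`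

/-- The `κ`-partial of the swapped function is multiplication by `∂F/∂κ`. [folklore] -/
theorem fderiv_sphmShootSwap_comp_inl (m : ℕ) (κ₀ ν₀ : ℂ) :
    (fderiv ℂ (sphmShootSwap m) (κ₀, ν₀)).comp (ContinuousLinearMap.inl ℂ ℂ ℂ) =
      (fderiv ℂ (sphmShoot m) (ν₀, κ₀) (0, 1)) • ContinuousLinearMap.id ℂ ℂ := by
  have hF : DifferentiableAt ℂ (sphmShoot m) (ν₀, κ₀) :=
    (contDiff_sphmShoot m (n := 1) (by exact_mod_cast le_top)).differentiable one_ne_zero _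
  have hswap : HasFDerivAt (fun q : ℂ × ℂ ↦ (q.2, q.1))
      ((ContinuousLinearMap.snd ℂ ℂ ℂ).prod (ContinuousLinearMap.fst ℂ ℂ ℂ)) (κ₀, ν₀) :=
    hasFDerivAt_snd.prodMk hasFDerivAt_fst
  have hcomp : HasFDerivAt (sphmShootSwap m)
      ((fderiv ℂ (sphmShoot m) (ν₀, κ₀)).comp ((ContinuousLinearMap.snd ℂ ℂ ℂ).prod (ContinuousLinearMap.fst ℂ ℂ ℂ)))
      (κ₀, ν₀) := hF.hasFDerivAt.comp (κ₀, ν₀) hswap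
  rw [hcomp.fderiv]
  ext
  simp

/-- Multiplication by a non-zero scalar is an invertible continuous linear map. [folklore] -/
theorem isInvertible_smul_id {c : ℂ} (hc : c ≠ 0) : (c • ContinuousLinearMap.id ℂ ℂ).IsInvertible :=
  ContinuousLinearMap.IsInvertible.of_inverse (g := c⁻¹ • ContinuousLinearMap.id ℂ ℂ)
    (by ext; simp [hc]) (by ext; simp [hc])

/-- **The local branch through a non-degenerate zero** (implicit function theorem over `ℂ`): if
`F(ν₀, κ₀) = 0` and `∂F/∂ν (ν₀, κ₀) ≠ 0`, there is `g : ℂ → ℂ`, holomorphic near `κ₀`, with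
`g κ₀ = ν₀`, `F(g κ, κ) = 0` for `κ` near `κ₀`, and — local uniqueness — every zero `(ν, κ)` of `F`
near `(ν₀, κ₀)` has `ν = g κ`; moreover `g' κ₀ = −(∂F/∂κ)/(∂F/∂ν)`. SR App. B Prop. B.1 ("we can
uniquely find a holomorphic curve `λ(κ)` of eigenvalues").
[cite: ShlapentokhRothman2014KleinGordon, App. B Prop. B.1] -/
theorem exists_local_branch {ν₀ κ₀ : ℂ} (h0 : sphmShoot m (ν₀, κ₀) = 0)
    (hν : fderiv ℂ (sphmShoot m) (ν₀, κ₀) (1, 0) ≠ 0) :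
    ∃ g : ℂ → ℂ, g κ₀ = ν₀ ∧ (∀ᶠ κ in 𝓝 κ₀, sphmShoot m (g κ, κ) = 0) ∧
      (∀ᶠ κ in 𝓝 κ₀, DifferentiableAt ℂ g κ) ∧
      (∀ᶠ q in 𝓝 ((ν₀, κ₀) : ℂ × ℂ), sphmShoot m q = 0 → q.1 = g q.2) ∧
      HasDerivAt g (-(fderiv ℂ (sphmShoot m) (ν₀, κ₀) (0, 1) / fderiv ℂ (sphmShoot m) (ν₀, κ₀) (1, 0))) κ₀ := by
  set u : ℂ × ℂ := (κ₀, ν₀) with hu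
  have hcd : ContDiffAt ℂ ∞ (sphmShootSwap m) u := (contDiff_sphmShootSwap m le_rfl).contDiffAt
  have hinv : ((fderiv ℂ (sphmShootSwap m) u).comp (ContinuousLinearMap.inr ℂ ℂ ℂ)).IsInvertible := by
    rw [hu, fderiv_sphmShootSwap_comp_inr]
    exact isInvertible_smul_id hν
  have htop : (∞ : WithTop ℕ∞) ≠ 0 := by simp
  set g := hcd.implicitFunction htop hinv with hg
  have hval : sphmShootSwap m u = 0 := by simp [hu, sphmShootSwap, h0]
  refine ⟨g, ?_, ?_, ?_, ?_, ?_⟩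
  · exact hcd.implicitFunction_apply_self htop hinv
  · have h := hcd.eventually_apply_implicitFunction htop hinv
    rw [hval] at h
    exact h.mono fun κ hκ ↦ by simpa [sphmShootSwap] using hκ
  · have hc : ContDiffAt ℂ ∞ g u.1 := hcd.contDiffAt_implicitFunction htop hinv
    have hc1 : ContDiffAt ℂ 1 g κ₀ := hc.of_le (by exact_mod_cast le_top)
    exact (hc1.eventually (by simp)).mono fun κ hκ ↦ hκ.differentiableAt one_ne_zero
  · have h := hcd.eventually_apply_eq_iff_implicitFunction htop hinv
    rw [hval] at h
    -- transport along the homeomorphism `swap`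
    have hsw : Tendsto (fun q : ℂ × ℂ ↦ (q.2, q.1)) (𝓝 ((ν₀, κ₀) : ℂ × ℂ)) (𝓝 u) := by
      rw [hu]; exact (continuous_snd.prodMk continuous_fst).tendsto (ν₀, κ₀)
    filter_upwards [hsw.eventually h] with q hq hFq
    have : sphmShootSwap m (q.2, q.1) = 0 := by simpa [sphmShootSwap] using hFq
    exact (hq.1 this).symm
  · have hs := hcd.hasStrictFDerivAt_implicitFunction htop hinv
    rw [fderiv_sphmShootSwap_comp_inr, fderiv_sphmShootSwap_comp_inl] at hs
    have hd := hs.hasFDerivAt.hasDerivAt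
    refine hd.congr_deriv ?_
    rw [ContinuousLinearMap.inverse_eq (g := (fderiv ℂ (sphmShoot m) (ν₀, κ₀) (1, 0))⁻¹ • ContinuousLinearMap.id ℂ ℂ)
      (by ext; simp [hν]) (by ext; simp [hν])]
    simp [div_eq_mul_inv, mul_comm]

/-- **Real zeros give real branches.** In the situation of `exists_local_branch` with `ν₀, κ₀`
real, the branch is real at real `κ` near `κ₀` (both `g κ` and its conjugate are zeros of `F(·, κ)`
close to `ν₀`, and zeros are locally unique). [folklore] -/
theorem local_branch_real {ν₀ κ₀ : ℂ} (hν₀ : ν₀.im = 0) (hκ₀ : κ₀.im = 0) {g : ℂ → ℂ} (hg0 : g κ₀ = ν₀)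
    (hzero : ∀ᶠ κ in 𝓝 κ₀, sphmShoot m (g κ, κ) = 0)
    (huniq : ∀ᶠ q in 𝓝 ((ν₀, κ₀) : ℂ × ℂ), sphmShoot m q = 0 → q.1 = g q.2)
    (hcont : ContinuousAt g κ₀) :
    ∀ᶠ κ : ℝ in 𝓝 κ₀.re, (g κ).im = 0 := by
  open scoped ComplexConjugate in
  have hκ₀eq : ((κ₀.re : ℝ) : ℂ) = κ₀ := by
    apply Complex.ext <;> simp [hκ₀]
  -- `(conj (g κ), κ) → (ν₀, κ₀)` as real `κ → re κ₀`
  have hof : Tendsto (fun κ : ℝ ↦ (κ : ℂ)) (𝓝 κ₀.re) (𝓝 κ₀) := by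
    have := Complex.continuous_ofReal.tendsto κ₀.re
    rwa [hκ₀eq] at this
  have hgt : Tendsto (fun κ : ℝ ↦ g κ) (𝓝 κ₀.re) (𝓝 ν₀) := by
    have := hcont.tendsto.comp hof
    rwa [hg0] at this
  have hconj : Tendsto (fun κ : ℝ ↦ (conj (g κ), (κ : ℂ))) (𝓝 κ₀.re) (𝓝 ((ν₀, κ₀) : ℂ × ℂ)) := by
    have h1 : Tendsto (fun κ : ℝ ↦ conj (g κ)) (𝓝 κ₀.re) (𝓝 (conj ν₀)) :=
      (Complex.continuous_conj.tendsto ν₀).comp hgt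
    rw [Complex.conj_eq_iff_im.2 hν₀] at h1
    exact h1.prodMk_nhds hof
  filter_upwards [hconj.eventually huniq, hof.eventually hzero] with κ hu hz
  -- `conj (g κ)` is a zero of `F(·, κ)`
  have hz' : sphmShoot m (conj (g κ), (κ : ℂ)) = 0 := by
    have := sphmShoot_conj m (g κ) (κ : ℂ)
    rw [Complex.conj_ofReal] at this
    rw [this, hz, map_zero]
  have heq : conj (g κ) = g κ := hu hz'
  exact Complex.conj_eq_iff_im.1 heq

end LocalBranch

/-! ### Real zeros and local real branches with derivative control -/

section RealBranch

variable (m : ℕ)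

/-- `(ν, κ) ∈ ℝ²` is a **real zero** of the shooting function: `F(ν, κ) = 0`. [folklore] -/
def IsRealZero (ν κ : ℝ) : Prop := sphmShoot m ((ν : ℂ), (κ : ℂ)) = 0

/-- **Local real branch data** at a real zero `(ν₀, κ₀)`: a real function `γ` on the window
`(κ₀ − δ, κ₀ + δ)` through `(ν₀, κ₀)`, consisting of real zeros, differentiable with
`−1 ≤ γ' ≤ 0`, and capturing every real zero in the box `(κ₀ − δ, κ₀ + δ) × (ν₀ − δ, ν₀ + δ)`.
[cite: ShlapentokhRothman2014KleinGordon, App. B Prop. B.1] -/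
structure LocalRealBranch (ν₀ κ₀ : ℝ) where
  /-- the branch -/
  γ : ℝ → ℝ
  /-- its derivative -/
  γ' : ℝ → ℝ
  /-- the size of the box -/
  δ : ℝ
  δ_pos : 0 < δ
  γ_apply : γ κ₀ = ν₀
  isRealZero : ∀ κ ∈ Ioo (κ₀ - δ) (κ₀ + δ), IsRealZero m (γ κ) κ
  hasDerivAt : ∀ κ ∈ Ioo (κ₀ - δ) (κ₀ + δ), HasDerivAt γ (γ' κ) κ
  deriv_mem : ∀ κ ∈ Ioo (κ₀ - δ) (κ₀ + δ), γ' κ ∈ Icc (-1 : ℝ) 0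
  unique : ∀ κ ν : ℝ, κ ∈ Ioo (κ₀ - δ) (κ₀ + δ) → ν ∈ Ioo (ν₀ - δ) (ν₀ + δ) → IsRealZero m ν κ → ν = γ κ

variable {m}

/-- The derivative of a complex zero-branch at a real point where it is real: it equals
`−(∂F/∂κ)/(∂F/∂ν)` at that point, hence is `−r` with `0 ≤ r ≤ 1`. [folklore] -/
theorem hasDerivAt_branch_of_zero {g : ℂ → ℂ} {κ : ℂ} (hκ : κ.im = 0) (hgκ : (g κ).im = 0)
    (hz : ∀ᶠ κ' in 𝓝 κ, sphmShoot m (g κ', κ') = 0) (hd : DifferentiableAt ℂ g κ) :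
    ∃ r : ℝ, 0 ≤ r ∧ r ≤ 1 ∧ HasDerivAt g (-(r : ℂ)) κ := by
  have h0 : sphmShoot m (g κ, κ) = 0 := hz.self_of_nhds
  obtain ⟨hFν, -, -⟩ := sphmShoot_dnu_ne_zero (m := m) hgκ hκ h0
  obtain ⟨g₂, hg₂0, -, -, huniq₂, hderiv₂⟩ := exists_local_branch (m := m) h0 hFν
  obtain ⟨r, hr0, hr1, hratio⟩ := sphmShoot_ratio_mem (m := m) hgκ hκ h0
  -- `g = g₂` near `κ`
  have hcont : ContinuousAt g κ := hd.continuousAt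
  have hpair : Tendsto (fun κ' ↦ (g κ', κ')) (𝓝 κ) (𝓝 (g κ, κ)) := hcont.tendsto.prodMk_nhds tendsto_id
  have heq : g =ᶠ[𝓝 κ] g₂ := by
    filter_upwards [hpair.eventually huniq₂, hz] with κ' hu hz'
    exact hu hz'
  refine ⟨r, hr0, hr1, ?_⟩
  have := hderiv₂.congr_of_eventuallyEq heq
  refine this.congr_deriv ?_
  rw [hratio, mul_div_assoc, div_self hFν, mul_one]

/-- **Existence of local real branch data at every real zero.**
[cite: ShlapentokhRothman2014KleinGordon, App. B Prop. B.1] -/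
theorem exists_localRealBranch {ν₀ κ₀ : ℝ} (h0 : IsRealZero m ν₀ κ₀) : Nonempty (LocalRealBranch m ν₀ κ₀) := by
  have hν0 : ((ν₀ : ℂ)).im = 0 := Complex.ofReal_im ν₀
  have hκ0 : ((κ₀ : ℂ)).im = 0 := Complex.ofReal_im κ₀
  obtain ⟨hFν, -, -⟩ := sphmShoot_dnu_ne_zero (m := m) hν0 hκ0 h0
  obtain ⟨g, hg0, hzero, hdiff, huniq, -⟩ := exists_local_branch (m := m) h0 hFν
  have hcont0 : ContinuousAt g κ₀ := (hdiff.self_of_nhds).continuousAt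
  have hreal := local_branch_real (m := m) hν0 hκ0 hg0 hzero huniq hcont0
  rw [Complex.ofReal_re] at hreal
  -- transport the complex-filter facts to the real line
  have hof : Tendsto (fun κ : ℝ ↦ (κ : ℂ)) (𝓝 κ₀) (𝓝 (κ₀ : ℂ)) := Complex.continuous_ofReal.tendsto κ₀
  have hzero' : ∀ᶠ κ : ℝ in 𝓝 κ₀, ∀ᶠ κ' in 𝓝 (κ : ℂ), sphmShoot m (g κ', κ') = 0 :=
    hof.eventually (eventually_eventually_nhds.2 hzero)
  have hdiff' : ∀ᶠ κ : ℝ in 𝓝 κ₀, DifferentiableAt ℂ g κ := hof.eventually hdiff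
  -- the real function and its derivative
  set γ : ℝ → ℝ := fun κ ↦ (g κ).re with hγ
  have hder : ∀ᶠ κ : ℝ in 𝓝 κ₀, ∃ r : ℝ, 0 ≤ r ∧ r ≤ 1 ∧ HasDerivAt γ (-r) κ ∧ IsRealZero m (γ κ) κ := by
    filter_upwards [hreal, hzero', hdiff'] with κ hre hz hd
    obtain ⟨r, hr0, hr1, hgd⟩ := hasDerivAt_branch_of_zero (m := m) (Complex.ofReal_im κ) hre hz hd
    refine ⟨r, hr0, hr1, ?_, ?_⟩
    · have := hgd.real_of_complex
      simpa [hγ] using this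
    · -- `F(γ κ, κ) = F(g κ, κ) = 0`
      have hgeq : ((γ κ : ℝ) : ℂ) = g κ := by
        rw [hγ]; exact Complex.ext (by simp) (by simp [hre])
      show sphmShoot m (((γ κ : ℝ) : ℂ), (κ : ℂ)) = 0
      rw [hgeq]; exact hz.self_of_nhds
  -- radii
  obtain ⟨δ₁, hδ₁, hδ₁p⟩ := Metric.eventually_nhds_iff.1 hder
  obtain ⟨δ₂, hδ₂, hδ₂p⟩ := Metric.eventually_nhds_iff.1 huniq
  have hδ₁p' : ∀ κ : ℝ, dist κ κ₀ < δ₁ → ∃ r : ℝ, 0 ≤ r ∧ r ≤ 1 ∧ HasDerivAt γ (-r) κ ∧ IsRealZero m (γ κ) κ :=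
    fun κ hκ ↦ hδ₁p hκ
  choose! rf hrf using hδ₁p'
  set δ := min δ₁ δ₂ with hδ
  have hδ0 : 0 < δ := lt_min hδ₁ hδ₂
  have hwin : ∀ κ ∈ Ioo (κ₀ - δ) (κ₀ + δ), dist κ κ₀ < δ₁ := fun κ hκ ↦ by
    rw [Real.dist_eq, abs_lt]; constructor <;> linarith [hκ.1, hκ.2, min_le_left δ₁ δ₂]
  refine ⟨LocalRealBranch.mk γ (fun κ ↦ -rf κ) δ hδ0 ?_ ?_ ?_ ?_ ?_⟩
  · simp [hγ, hg0]
  · exact fun κ hκ ↦ (hrf κ (hwin κ hκ)).2.2.2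
  · exact fun κ hκ ↦ (hrf κ (hwin κ hκ)).2.2.1
  · intro κ hκ
    obtain ⟨hr0, hr1, -, -⟩ := hrf κ (hwin κ hκ)
    exact ⟨by linarith, by linarith⟩
  · intro κ ν hκ hν hz
    have hdist : dist (((ν : ℂ), (κ : ℂ)) : ℂ × ℂ) ((ν₀ : ℂ), (κ₀ : ℂ)) < δ₂ := by
      rw [Prod.dist_eq, Complex.dist_eq, Complex.dist_eq, ← Complex.ofReal_sub, ← Complex.ofReal_sub,
        Complex.norm_real, Complex.norm_real, Real.norm_eq_abs, Real.norm_eq_abs]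
      refine max_lt ?_ ?_
      · rw [abs_lt]; constructor <;> linarith [hν.1, hν.2, min_le_right δ₁ δ₂]
      · rw [abs_lt]; constructor <;> linarith [hκ.1, hκ.2, min_le_right δ₁ δ₂]
    have h := hδ₂p hdist hz
    simp only at h
    -- `ν = g κ` as complex numbers, so `ν = re (g κ) = γ κ`
    have := congrArg Complex.re h
    simpa [hγ] using this

namespace LocalRealBranch

variable {ν₀ κ₀ : ℝ} (B : LocalRealBranch m ν₀ κ₀)

/-- The branch is continuous on its window. [folklore] -/
theorem continuousOn : ContinuousOn B.γ (Ioo (κ₀ - B.δ) (κ₀ + B.δ)) := fun κ hκ ↦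
  (B.hasDerivAt κ hκ).continuousAt.continuousWithinAt

/-- The branch is antitone and `1`-Lipschitz on its window: for `κ₁ ≤ κ₂` in the window,
`γ κ₂ ≤ γ κ₁ ≤ γ κ₂ + (κ₂ − κ₁)`. [folklore] -/
theorem le_and_le {κ₁ κ₂ : ℝ} (h₁ : κ₁ ∈ Ioo (κ₀ - B.δ) (κ₀ + B.δ)) (h₂ : κ₂ ∈ Ioo (κ₀ - B.δ) (κ₀ + B.δ))
    (h12 : κ₁ ≤ κ₂) : B.γ κ₂ ≤ B.γ κ₁ ∧ B.γ κ₁ ≤ B.γ κ₂ + (κ₂ - κ₁) := by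
  have hconv : Convex ℝ (Ioo (κ₀ - B.δ) (κ₀ + B.δ)) := convex_Ioo _ _
  have hdiff : DifferentiableOn ℝ B.γ (interior (Ioo (κ₀ - B.δ) (κ₀ + B.δ))) := by
    rw [interior_Ioo]; exact fun κ hκ ↦ (B.hasDerivAt κ hκ).differentiableAt.differentiableWithinAt
  have hderiv : ∀ κ ∈ interior (Ioo (κ₀ - B.δ) (κ₀ + B.δ)), deriv B.γ κ = B.γ' κ := by
    rw [interior_Ioo]; exact fun κ hκ ↦ (B.hasDerivAt κ hκ).deriv
  constructor
  · -- antitone: `deriv ≤ 0`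
    have h := hconv.image_sub_le_mul_sub_of_deriv_le B.continuousOn hdiff
      (fun κ hκ ↦ by rw [hderiv κ hκ]; exact (B.deriv_mem κ (by rwa [interior_Ioo] at hκ)).2) κ₁ h₁ κ₂ h₂ h12
    linarith
  · -- `deriv ≥ −1`
    have h := hconv.mul_sub_le_image_sub_of_le_deriv B.continuousOn hdiff
      (fun κ hκ ↦ by rw [hderiv κ hκ]; exact (B.deriv_mem κ (by rwa [interior_Ioo] at hκ)).1) κ₁ h₁ κ₂ h₂ h12
    linarith

/-- `|γ κ − ν₀| ≤ |κ − κ₀|` on the window. [folklore] -/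
theorem abs_sub_le {κ : ℝ} (hκ : κ ∈ Ioo (κ₀ - B.δ) (κ₀ + B.δ)) : |B.γ κ - ν₀| ≤ |κ - κ₀| := by
  have h0 : κ₀ ∈ Ioo (κ₀ - B.δ) (κ₀ + B.δ) := ⟨by linarith [B.δ_pos], by linarith [B.δ_pos]⟩
  have e : |B.γ κ - ν₀| = |B.γ κ - B.γ κ₀| := by rw [B.γ_apply]
  rw [e]
  rcases le_total κ κ₀ with h | h
  · obtain ⟨h1, h2⟩ := B.le_and_le hκ h0 h
    rw [abs_of_nonneg (by linarith), abs_of_nonpos (by linarith)]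
    linarith
  · obtain ⟨h1, h2⟩ := B.le_and_le h0 hκ h
    rw [abs_of_nonpos (by linarith), abs_of_nonneg (by linarith)]
    linarith

end LocalRealBranch

end RealBranch

/-! ### Continuation along real `κ ∈ [−K, 0]` -/

section Continuation

variable (m : ℕ)

/-- **A normalised continuous real branch on `[c, 0]`**: continuous, made of real zeros, with the
value `ν₀` at `κ = 0` and the a priori bound `|γ κ − ν₀| ≤ |κ|`. [folklore] -/
structure IsGlobalBranch (ν₀ : ℝ) (γ : ℝ → ℝ) (c : ℝ) : Prop where
  nonpos : c ≤ 0
  continuousOn : ContinuousOn γ (Icc c 0)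
  apply_zero : γ 0 = ν₀
  isRealZero : ∀ κ ∈ Icc c 0, IsRealZero m (γ κ) κ
  bound : ∀ κ ∈ Icc c 0, |γ κ - ν₀| ≤ |κ|

/-- The set of real zeros `(κ, ν)` with `κ ∈ [−K, 0]`, `|ν − ν₀| ≤ K`. [folklore] -/
def realZeroSet (ν₀ K : ℝ) : Set (ℝ × ℝ) :=
  {q | q.1 ∈ Icc (-K) 0 ∧ |q.2 - ν₀| ≤ K ∧ IsRealZero m q.2 q.1}

variable {m}

/-- The real-zero condition is a closed condition. [folklore] -/
theorem isClosed_isRealZero : IsClosed {q : ℝ × ℝ | IsRealZero m q.2 q.1} := by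
  have hc : Continuous fun q : ℝ × ℝ ↦ sphmShoot m (((q.2 : ℝ) : ℂ), ((q.1 : ℝ) : ℂ)) :=
    (contDiff_sphmShoot m (n := 0) (by exact_mod_cast le_top)).continuous.comp (by fun_prop)
  exact isClosed_eq hc continuous_const

/-- The bounded real zero set is compact. [folklore] -/
theorem isCompact_realZeroSet (ν₀ K : ℝ) : IsCompact (realZeroSet m ν₀ K) := by
  have hsub : realZeroSet m ν₀ K ⊆ Icc (-K) 0 ×ˢ Icc (ν₀ - K) (ν₀ + K) := fun q hq ↦
    ⟨hq.1, by have := abs_le.1 hq.2.1; constructor <;> linarith [this.1, this.2]⟩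
  refine (isCompact_Icc.prod isCompact_Icc).of_isClosed_subset ?_ hsub
  have h1 : IsClosed {q : ℝ × ℝ | q.1 ∈ Icc (-K) 0} := isClosed_Icc.preimage continuous_fst
  have h2 : IsClosed {q : ℝ × ℝ | |q.2 - ν₀| ≤ K} :=
    isClosed_le (continuous_abs.comp (continuous_snd.sub continuous_const)) continuous_const
  exact h1.inter (h2.inter (isClosed_isRealZero (m := m)))

/-- **A Lebesgue number for the local branches.** For every `K` there is `λ > 0` such that every
point `q` of the bounded real zero set has its `λ`-ball (a box) inside the box of some local real
branch datum. [folklore] -/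
theorem exists_lebesgue_localRealBranch (ν₀ K : ℝ) :
    ∃ lam > 0, ∀ q ∈ realZeroSet m ν₀ K, ∃ (κ₁ ν₁ : ℝ) (B : LocalRealBranch m ν₁ κ₁),
      Ioo (q.1 - lam) (q.1 + lam) ⊆ Ioo (κ₁ - B.δ) (κ₁ + B.δ) ∧
        Ioo (q.2 - lam) (q.2 + lam) ⊆ Ioo (ν₁ - B.δ) (ν₁ + B.δ) := by
  -- one local datum at each real zero
  have hB : ∀ z : realZeroSet m ν₀ K, Nonempty (LocalRealBranch m z.1.2 z.1.1) := fun z ↦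
    exists_localRealBranch z.2.2.2
  set U : realZeroSet m ν₀ K → Set (ℝ × ℝ) := fun z ↦
    Ioo (z.1.1 - (hB z).some.δ) (z.1.1 + (hB z).some.δ) ×ˢ Ioo (z.1.2 - (hB z).some.δ) (z.1.2 + (hB z).some.δ)
    with hU
  have hUo : ∀ z, IsOpen (U z) := fun z ↦ isOpen_Ioo.prod isOpen_Ioo
  have hcov : realZeroSet m ν₀ K ⊆ ⋃ z, U z := fun q hq ↦ by
    refine mem_iUnion.2 ⟨⟨q, hq⟩, ?_⟩
    have hδ := (hB ⟨q, hq⟩).some.δ_pos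
    exact ⟨⟨by linarith, by linarith⟩, ⟨by linarith, by linarith⟩⟩
  obtain ⟨lam, hlam, hleb⟩ := lebesgue_number_lemma_of_metric (isCompact_realZeroSet (m := m) ν₀ K) hUo hcov
  refine ⟨lam, hlam, fun q hq ↦ ?_⟩
  obtain ⟨z, hz⟩ := hleb q hq
  refine ⟨z.1.1, z.1.2, (hB z).some, fun κ hκ ↦ ?_, fun ν hν ↦ ?_⟩
  · have hmem : (κ, q.2) ∈ ball q lam := by
      rw [mem_ball, Prod.dist_eq, Real.dist_eq, dist_self, max_lt_iff]
      exact ⟨by rw [abs_lt]; constructor <;> linarith [hκ.1, hκ.2], hlam⟩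
    exact (hz hmem).1
  · have hmem : (q.1, ν) ∈ ball q lam := by
      rw [mem_ball, Prod.dist_eq, dist_self, Real.dist_eq, max_lt_iff]
      exact ⟨hlam, by rw [abs_lt]; constructor <;> linarith [hν.1, hν.2]⟩
    exact (hz hmem).2

/-- **The uniform extension step.** With `λ` a Lebesgue number as above, a normalised branch on
`[c, 0]` (`−K ≤ c`) extends to one on `[max (c − λ/2) (−K), 0]`. [folklore] -/
theorem IsGlobalBranch.extend {ν₀ K : ℝ} (hK : 0 ≤ K) {lam : ℝ} (hlam : 0 < lam)
    (hleb : ∀ q ∈ realZeroSet m ν₀ K, ∃ (κ₁ ν₁ : ℝ) (B : LocalRealBranch m ν₁ κ₁),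
      Ioo (q.1 - lam) (q.1 + lam) ⊆ Ioo (κ₁ - B.δ) (κ₁ + B.δ) ∧
        Ioo (q.2 - lam) (q.2 + lam) ⊆ Ioo (ν₁ - B.δ) (ν₁ + B.δ))
    {γ : ℝ → ℝ} {c : ℝ} (hγ : IsGlobalBranch m ν₀ γ c) (hc : -K ≤ c) :
    ∃ γ' : ℝ → ℝ, IsGlobalBranch m ν₀ γ' (max (c - lam / 2) (-K)) ∧ EqOn γ' γ (Icc c 0) := by
  classical
  have hc0 : c ≤ 0 := hγ.nonpos
  -- the endpoint zero and its local datum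
  have hq : (c, γ c) ∈ realZeroSet m ν₀ K := by
    refine ⟨⟨hc, hc0⟩, ?_, hγ.isRealZero c ⟨le_rfl, hc0⟩⟩
    have := hγ.bound c ⟨le_rfl, hc0⟩
    rw [abs_of_nonpos hc0] at this
    linarith
  obtain ⟨κ₁, ν₁, B, hκw, hνw⟩ := hleb _ hq
  simp only at hκw hνw
  have hcw : c ∈ Ioo (κ₁ - B.δ) (κ₁ + B.δ) := hκw ⟨by linarith, by linarith⟩
  have hγcw : γ c ∈ Ioo (ν₁ - B.δ) (ν₁ + B.δ) := hνw ⟨by linarith, by linarith⟩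
  have hBc : γ c = B.γ c := B.unique c (γ c) hcw hγcw (hγ.isRealZero c ⟨le_rfl, hc0⟩)
  -- the glued function
  set c' := max (c - lam / 2) (-K) with hc'
  have hc'c : c' ≤ c := max_le (by linarith) hc
  have hc'w : ∀ κ ∈ Icc c' c, κ ∈ Ioo (κ₁ - B.δ) (κ₁ + B.δ) := fun κ hκ ↦
    hκw ⟨by linarith [hκ.1, le_max_left (c - lam / 2) (-K)], by linarith [hκ.2]⟩
  set γ' : ℝ → ℝ := (Ici c).piecewise γ B.γ with hγ'
  have hγ'_ge : ∀ κ, c ≤ κ → γ' κ = γ κ := fun κ hκ ↦ Set.piecewise_eq_of_mem _ _ _ (mem_Ici.2 hκ)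
  have hγ'_lt : ∀ κ, κ < c → γ' κ = B.γ κ := fun κ hκ ↦ Set.piecewise_eq_of_notMem _ _ _ (by simpa using hκ)
  refine ⟨γ', ⟨?_, ?_, ?_, ?_, ?_⟩, fun κ hκ ↦ hγ'_ge κ hκ.1⟩
  · exact max_le (by linarith) (by linarith)
  · -- continuity of the glued function on `[c', 0]`
    refine ContinuousOn.piecewise ?_ ?_ ?_
    · intro κ hκ
      rw [frontier_Ici] at hκ
      have : κ = c := hκ.2
      rw [this, hBc]
    · rw [closure_Ici]
      exact hγ.continuousOn.mono fun κ hκ ↦ ⟨hκ.2, hκ.1.2⟩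
    · have hcl : closure (Ici c)ᶜ = Iic c := by rw [closure_compl, interior_Ici, compl_Ioi]
      rw [hcl]
      exact B.continuousOn.mono fun κ hκ ↦ hc'w κ ⟨hκ.1.1, hκ.2⟩
  · rw [hγ'_ge 0 hc0]; exact hγ.apply_zero
  · intro κ hκ
    rcases le_or_gt c κ with h | h
    · rw [hγ'_ge κ h]; exact hγ.isRealZero κ ⟨h, hκ.2⟩
    · rw [hγ'_lt κ h]; exact B.isRealZero κ (hc'w κ ⟨hκ.1, h.le⟩)
  · intro κ hκ
    rcases le_or_gt c κ with h | h
    · rw [hγ'_ge κ h]; exact hγ.bound κ ⟨h, hκ.2⟩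
    · rw [hγ'_lt κ h]
      obtain ⟨-, h2⟩ := B.le_and_le (hc'w κ ⟨hκ.1, h.le⟩) hcw h.le
      obtain ⟨h1, -⟩ := B.le_and_le (hc'w κ ⟨hκ.1, h.le⟩) hcw h.le
      have hb := hγ.bound c ⟨le_rfl, hc0⟩
      rw [abs_of_nonpos hc0] at hb
      rw [abs_of_nonpos (by linarith [hκ.2, h] : κ ≤ 0)]
      rw [← hBc] at h1 h2
      have := abs_le.1 hb
      rw [abs_le]
      constructor <;> linarith [this.1, this.2]

/-- The trivial branch on `[0, 0]`. [folklore] -/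
theorem IsGlobalBranch.zero {ν₀ : ℝ} (h0 : IsRealZero m ν₀ 0) : IsGlobalBranch m ν₀ (fun _ ↦ ν₀) 0 :=
  ⟨le_rfl, continuousOn_const, rfl, fun κ hκ ↦ by rw [le_antisymm hκ.2 hκ.1]; exact h0,
    fun κ hκ ↦ by simp⟩

/-- Restriction of a normalised branch to a smaller interval. [folklore] -/
theorem IsGlobalBranch.mono {ν₀ : ℝ} {γ : ℝ → ℝ} {c c' : ℝ} (h : IsGlobalBranch m ν₀ γ c) (hc' : c ≤ c')
    (hc'0 : c' ≤ 0) : IsGlobalBranch m ν₀ γ c' :=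
  ⟨hc'0, h.continuousOn.mono (Icc_subset_Icc_left hc'), h.apply_zero, fun κ hκ ↦ h.isRealZero κ ⟨hc'.trans hκ.1, hκ.2⟩,
    fun κ hκ ↦ h.bound κ ⟨hc'.trans hκ.1, hκ.2⟩⟩

/-- **Global continuation**: from a real zero `(ν₀, 0)` there is a normalised continuous real branch
on `[−K, 0]`, for every `K ≥ 0` (finitely many uniform extension steps).
[cite: ShlapentokhRothman2014KleinGordon, App. B Prop. B.1] -/
theorem exists_isGlobalBranch {ν₀ : ℝ} (h0 : IsRealZero m ν₀ 0) {K : ℝ} (hK : 0 ≤ K) :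
    ∃ γ : ℝ → ℝ, IsGlobalBranch m ν₀ γ (-K) := by
  obtain ⟨lam, hlam, hleb⟩ := exists_lebesgue_localRealBranch (m := m) ν₀ K
  -- `n` steps reach `max (−n λ/2) (−K)`
  have step : ∀ n : ℕ, ∃ γ : ℝ → ℝ, IsGlobalBranch m ν₀ γ (max (-(n * (lam / 2))) (-K)) := by
    intro n
    induction n with
    | zero =>
      refine ⟨fun _ ↦ ν₀, ?_⟩
      have : max (-((0 : ℕ) * (lam / 2))) (-K) = 0 := by simp [hK]
      rw [this]; exact IsGlobalBranch.zero h0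
    | succ n ih =>
      obtain ⟨γ, hγ⟩ := ih
      obtain ⟨γ', hγ', -⟩ := hγ.extend hK hlam hleb (le_max_right _ _)
      refine ⟨γ', ?_⟩
      have heq : max (max (-((n : ℝ) * (lam / 2))) (-K) - lam / 2) (-K) = max (-(((n + 1 : ℕ) : ℝ) * (lam / 2))) (-K) := by
        push_cast
        rcases le_total (-((n : ℝ) * (lam / 2))) (-K) with h | h
        · rw [max_eq_right h, max_eq_right (by linarith), max_eq_right (by nlinarith)]
        · rw [max_eq_left h]
          congr 1; ring
      rw [← heq]; exact hγ'
  obtain ⟨n, hn⟩ : ∃ n : ℕ, K ≤ n * (lam / 2) := by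
    obtain ⟨n, hn⟩ := exists_nat_ge (K / (lam / 2))
    exact ⟨n, by rwa [div_le_iff₀ (by positivity)] at hn⟩
  obtain ⟨γ, hγ⟩ := step n
  rw [max_eq_right (by linarith)] at hγ
  exact ⟨γ, hγ⟩

/-- **Local structure of a global branch**: at every interior point it coincides, near the point,
with the local real branch datum there; hence it is differentiable there with derivative in
`[−1, 0]`. [folklore] -/
theorem IsGlobalBranch.hasDerivAt {ν₀ : ℝ} {γ : ℝ → ℝ} {c : ℝ} (h : IsGlobalBranch m ν₀ γ c) {κ : ℝ}
    (hκ : κ ∈ Ioo c 0) : ∃ d ∈ Icc (-1 : ℝ) 0, HasDerivAt γ d κ := by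
  obtain ⟨B⟩ := exists_localRealBranch (h.isRealZero κ ⟨hκ.1.le, hκ.2.le⟩)
  have hcont : ContinuousAt γ κ := (h.continuousOn.mono Ioo_subset_Icc_self).continuousAt (Ioo_mem_nhds hκ.1 hκ.2)
  -- near `κ`, `γ` stays in the box of `B`, hence equals `B.γ`
  have h1 : ∀ᶠ κ' in 𝓝 κ, κ' ∈ Ioo (κ - B.δ) (κ + B.δ) := Ioo_mem_nhds (by linarith [B.δ_pos]) (by linarith [B.δ_pos])
  have h2 : ∀ᶠ κ' in 𝓝 κ, γ κ' ∈ Ioo (γ κ - B.δ) (γ κ + B.δ) :=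
    hcont.preimage_mem_nhds (Ioo_mem_nhds (by linarith [B.δ_pos]) (by linarith [B.δ_pos]))
  have h3 : ∀ᶠ κ' in 𝓝 κ, κ' ∈ Ioo c 0 := Ioo_mem_nhds hκ.1 hκ.2
  have heq : γ =ᶠ[𝓝 κ] B.γ := by
    filter_upwards [h1, h2, h3] with κ' hκ'1 hκ'2 hκ'3
    exact B.unique κ' (γ κ') hκ'1 hκ'2 (h.isRealZero κ' ⟨hκ'3.1.le, hκ'3.2.le⟩)
  have hw : κ ∈ Ioo (κ - B.δ) (κ + B.δ) := ⟨by linarith [B.δ_pos], by linarith [B.δ_pos]⟩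
  exact ⟨B.γ' κ, B.deriv_mem κ hw, (B.hasDerivAt κ hw).congr_of_eventuallyEq heq⟩

/-- **Monotonicity along a global branch**: `γ` is antitone and `κ ↦ γ κ + κ` is monotone on
`[c, 0]` (`−1 ≤ γ' ≤ 0`): SR App. B Prop. B.3 / Hellmann–Feynman. [cite: ShlapentokhRothman2014KleinGordon, App. B Prop. B.3] -/
theorem IsGlobalBranch.antitoneOn {ν₀ : ℝ} {γ : ℝ → ℝ} {c : ℝ} (h : IsGlobalBranch m ν₀ γ c) :
    AntitoneOn γ (Icc c 0) ∧ MonotoneOn (fun κ ↦ γ κ + κ) (Icc c 0) := by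
  have hint : interior (Icc c 0) = Ioo c 0 := interior_Icc
  have hd : ∀ κ ∈ Ioo c 0, DifferentiableAt ℝ γ κ ∧ deriv γ κ ∈ Icc (-1 : ℝ) 0 := fun κ hκ ↦ by
    obtain ⟨d, hd, hγd⟩ := h.hasDerivAt hκ
    exact ⟨hγd.differentiableAt, by rw [hγd.deriv]; exact hd⟩
  constructor
  · refine antitoneOn_of_deriv_nonpos (convex_Icc c 0) h.continuousOn ?_ ?_
    · rw [hint]; exact fun κ hκ ↦ (hd κ hκ).1.differentiableWithinAt
    · rw [hint]; exact fun κ hκ ↦ (hd κ hκ).2.2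
  · refine monotoneOn_of_deriv_nonneg (convex_Icc c 0) (h.continuousOn.add continuousOn_id) ?_ ?_
    · rw [hint]; exact fun κ hκ ↦ ((hd κ hκ).1.add differentiableAt_id).differentiableWithinAt
    · rw [hint]
      intro κ hκ
      have hda : HasDerivAt (fun κ ↦ γ κ + κ) (deriv γ κ + 1) κ := (hd κ hκ).1.hasDerivAt.add (hasDerivAt_id κ)
      rw [hda.deriv]
      linarith [(hd κ hκ).2.1]

/-- **A global branch agrees near any of its interior points with the complex local branch there**
(and that branch is holomorphic): for `κ*` interior there is `g : ℂ → ℂ`, differentiable near `κ*`,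
with `g κ = γ κ` for real `κ` near `κ*` and `F(g κ, κ) = 0` for complex `κ` near `κ*`.
[cite: ShlapentokhRothman2014KleinGordon, App. B Prop. B.1] -/
theorem IsGlobalBranch.exists_holomorphic_extension {ν₀ : ℝ} {γ : ℝ → ℝ} {c : ℝ}
    (h : IsGlobalBranch m ν₀ γ c) {κ : ℝ} (hκ : κ ∈ Ioo c 0) :
    ∃ g : ℂ → ℂ, g κ = γ κ ∧ (∀ᶠ κ' in 𝓝 (κ : ℂ), sphmShoot m (g κ', κ') = 0) ∧
      (∀ᶠ κ' in 𝓝 (κ : ℂ), DifferentiableAt ℂ g κ') ∧ (∀ᶠ κ' : ℝ in 𝓝 κ, g κ' = γ κ') := by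
  have h0 := h.isRealZero κ ⟨hκ.1.le, hκ.2.le⟩
  obtain ⟨hFν, -, -⟩ := sphmShoot_dnu_ne_zero (m := m) (Complex.ofReal_im _) (Complex.ofReal_im _) h0
  obtain ⟨g, hg0, hzero, hdiff, huniq, -⟩ := exists_local_branch (m := m) h0 hFν
  refine ⟨g, hg0, hzero, hdiff, ?_⟩
  have hcont : ContinuousAt γ κ := (h.continuousOn.mono Ioo_subset_Icc_self).continuousAt (Ioo_mem_nhds hκ.1 hκ.2)
  have hpair : Tendsto (fun κ' : ℝ ↦ (((γ κ' : ℝ) : ℂ), ((κ' : ℝ) : ℂ))) (𝓝 κ) (𝓝 (((γ κ : ℝ) : ℂ), ((κ : ℝ) : ℂ))) :=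
    ((Complex.continuous_ofReal.continuousAt.comp hcont).tendsto).prodMk_nhds (Complex.continuous_ofReal.tendsto κ)
  have h3 : ∀ᶠ κ' : ℝ in 𝓝 κ, κ' ∈ Ioo c 0 := Ioo_mem_nhds hκ.1 hκ.2
  filter_upwards [hpair.eventually huniq, h3] with κ' hu hκ'
  exact (hu (h.isRealZero κ' ⟨hκ'.1.le, hκ'.2.le⟩)).symm

/-- **The eigenvalue branches of the spheroidal problem** (packaged): for every `m`, every even
excess `n = l − m` and every `K ≥ 0` there is a continuous real function `κ ↦ ν(κ)` on `[−K, 0]`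
with `ν(0) = n(n + 2m + 1)` (the Legendre value, `SpheroidalHarmonicLegendre.lean`), such that
`ν(κ)` is a zero of the shooting function (so `S = sin^m θ · E(cos θ; ν(κ), κ)` is an angular
eigenfunction regular at both poles), `|ν(κ) − ν(0)| ≤ |κ|`, `ν` antitone, `ν + id` monotone.
[cite: ShlapentokhRothman2014KleinGordon, App. B Props. B.1, B.3] -/
theorem exists_eigenvalue_branch (m : ℕ) {n : ℕ} (hn : Even n) {K : ℝ} (hK : 0 ≤ K) :
    ∃ γ : ℝ → ℝ, IsGlobalBranch m (legNu m n).re γ (-K) ∧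
      AntitoneOn γ (Icc (-K) 0) ∧ MonotoneOn (fun κ ↦ γ κ + κ) (Icc (-K) 0) := by
  have h0 : IsRealZero m (legNu m n).re 0 := by
    have hre : (((legNu m n).re : ℝ) : ℂ) = legNu m n := Complex.ext (by simp) (by simp [legNu_im])
    show sphmShoot m ((((legNu m n).re : ℝ) : ℂ), ((0 : ℝ) : ℂ)) = 0
    rw [hre, Complex.ofReal_zero]
    exact sphmDer_one_eq_zero_of_even m hn
  obtain ⟨γ, hγ⟩ := exists_isGlobalBranch (m := m) h0 hK
  exact ⟨γ, hγ, hγ.antitoneOn⟩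

end Continuation

end Literature.Analysis.SpecialFunctions
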